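import Literature.NumberTheory.LFunctions.RealZeroRepulsionOddClassSummed
import Literature.NumberTheory.QuadraticFields.ReducedFormsLeadingCoefficients
import Literature.NumberTheory.QuadraticFields.ClassNumbersUpToOneHundred
import Literature.NumberTheory.LFunctions.ExplicitSiegelZeroBoundImaginaryQuadratic
import HarnessLib

/-!
# `1 − β > 18/√d` for every odd real primitive character whose field has class number `≥ 101`
# (hence, modulo Watkins' class-number tables, for ALL odd conductors `d > 2 383 747`), in the kernel;
# Ralaivaosaona–Razakarinoro 2026 Theorem 1 (`6.035/√d`, `d > 3·10⁸`) DERIVED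

Topic `Literature/NumberTheory/LFunctions` (namespace `Literature.NumberTheory.LFunctions`, sub-namespace
`ClassSumRepulsion`). Everything in this file is PROVED (theorems only; no definition, no NEW named fact);
the results «for all `d`» take the tree's named computational fact `watkins2004_table4` (Watkins, Math. Comp.
73 (2004), Table 4: every imaginary quadratic field with `h_K ≤ 100` has `|d_K| ≤ 2 383 747`) or, for the
small constant `2.5`, the class number one theorem (`mem_classNumberOneDiscrs_of_classNumber_eq_one`,
Heegner–Baker–Stark, Cox Thm. 7.30) as an explicit hypothesis. Cell `parity-realchar` (SIEGEL INSTRUMENT):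
TARGET §2 row 16, ODD column, v5; comparator row 14 (the 2026 print frontier).

## The assembly

* `RealZeroRepulsionOddClassSummed.lean` (class-summed Goldfeld–Schinzel, kernel): for the odd real primitive
  `χ` mod `d > 4`, `0 < c`, `10c ≤ √d` and `c·(π/6 + 2.6c/√d)·Σ_{Q reduced} 1/a_Q ≤ h(−d)` ⇒
  `Re L(σ, χ) > 0` on `[1 − c/√d, 1)`, so every real zero `β < 1` has `1 − β > c/√d`;
* `ReducedFormsLeadingCoefficients.lean` (kernel census): `Σ_Q 1/a_Q ≤ h(−d)/30 + 6.2605`, so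
  `h(−d) ≥ 101 ⇒ 10.49·Σ_Q 1/a_Q ≤ h(−d)`; and `Σ_Q 1/a_Q ≤ (h(−d) + 1)/2`;
* numerics: `18·(π/6 + 2.6·18/√d) ≤ 10.27 ≤ 10.49` for `√d ≥ 10³`; `19·(…) ≤ 10.42` for `√d ≥ 2·10³`;
  `20·(…) ≤ 10.489` for `√d ≥ 63245`; `2.5·(π/6 + 6.5/√d) ≤ 4/3` for `√d ≥ 707`.

## Results (odd real primitive `χ` mod `d`, every real `β < 1` with `L(β, χ) = 0`)

* `one_sub_realZero_gt_of_hundred_one_le` — the general step: `h(−d) ≥ 101`, `c(π/6 + 2.6c/√d) ≤ 10.49`,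
  `10c ≤ √d` ⇒ `1 − β > c/√d`;
* **`one_sub_realZero_gt_eighteen_of_classNumber_ge`** — `h(−d) ≥ 101`, `d ≥ 10⁶` ⇒ **`1 − β > 18/√d`**;
  `…nineteen…` (`d ≥ 4·10⁶`), `…twenty…` (`d ≥ 4·10⁹`); field-side forms with `h_K` (`…_field`);
* **modulo `watkins2004_table4`**: `one_sub_realZero_gt_eighteen_of_watkins` — **every odd `d > 2 383 747`:
  `1 − β > 18/√d`**; `…nineteen_of_watkins` (`d ≥ 4·10⁶`), `…twenty_of_watkins` (`d ≥ 4·10⁹`);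
* **`ralaivaosaonaRazakarinoro2026_theorem1_of_watkins : watkins2004_table4 → ralaivaosaonaRazakarinoro2026_theorem1`**
  — the 2026 print frontier `1 − β > 6.035/√d` (`d > 3·10⁸`), typed AS PRINTED in
  `ExplicitSiegelZeroBoundImaginaryQuadratic.lean` as a named fact, is now a CONSEQUENCE of Watkins' table
  (which the source itself invokes, p. 797: "Combining the results from [37] and [36] guarantees that we may
  only consider the case where the class number […] is at least 101") — with the constant tripled;
* `one_sub_realZero_gt_five_halves_of_two_le` — `h(−d) ≥ 2`, `d ≥ 5·10⁵` ⇒ `1 − β > 2.5/√d` (Pintz's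
  `12/π·h/(h+1)` mechanism: one reduced form has `a = 1`); `…_of_classNumberOne` — the same for every odd
  `d ≥ 5·10⁵` modulo the class number one theorem;
* quality readings on the column's predicate: `isSiegelZero_quality_lt_of_hundred_one_le`
  (`η < √d/(18 log d)`), `isSiegelZero_quality_lt_of_watkins` (all odd `d > 2 383 747`).

Comparators: v4 kernel `1.5/√d` (`d ≥ 441`), `1.9/√d` (`d ≥ 2.2·10⁶`) hypothesis-free (p530247); print
Goldfeld–Schinzel 1975 `(6/π − ε)/√d`, Pintz 1976 `12/π`, `16/π` (asymptotic), Ralaivaosaona–Razakarinoro 2026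
`6.035/√d` (`d > 3·10⁸`, via `h ≥ 101` from the same Watkins table and Perron's formula). The ideal constant of
the method at `h ≥ 101` is `(6/π)·10.49 ≈ 20.04`.

LABEL (cell rule): TARGET row 16 ODD column; kernel modulo ONE published computational fact (Watkins 2004,
seven CPU-months, vendored AS PRINTED by `littype-FP2-2`), fact-free in the `h(−d) ≥ 101` form. WHAT THIS IS
NOT: nothing for even characters; not a Siegel-type bound; no lower bound for `h(−d)` is proved in the
kernel; nothing here bears on parity (H5).

## References

* [RalaivaosaonaRazakarinoro2026] D. Ralaivaosaona, F. B. Razakarinoro, J. Number Theory 281 (2026) 795–829,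
  Theorem 1 (p. 796), Lemma 2 (p. 803), p. 797 and §6 (the rôle of `h ≥ 101`).
* [Watkins2004ClassNumbers] M. Watkins, Math. Comp. 73 (2004) 907–938, Table 4 (p. 936), §8 (p. 935).
* [GoldfeldSchinzel1975] Theorem 1 and Corollary (case `d < 0`).
* [Cox2013] Thm. 7.30(ii) (class number one; tree named fact).
* [TaoTeravainen2021] Definition 1.4 (`IsSiegelZero`).
-/

noncomputable section

open Complex
open Literature.Barriers.Parity
open Literature.NumberTheory.QuadraticFields Literature.NumberTheory.QuadraticFields.Quadratic
open Literature.NumberTheory.QuadraticFields.BinaryQuadraticForm (reducedForms mem_reducedForms_iff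
  classNumberOneDiscrs mem_classNumberOneDiscrs_of_classNumber_eq_one principalForm_mem_reducedForms)
open Literature.NumberTheory.LFunctions.PrimitiveQuadratic (isFundamentalDiscriminant_neg)

namespace Literature.NumberTheory.LFunctions

namespace ClassSumRepulsion

/-! ### Numerics -/

/-- `π/6 < 0.5236`. [folklore] -/
private theorem pi_div_six_lt : Real.pi / 6 < 0.5236 := by
  have := Real.pi_lt_d4
  linarith

/-- `√d ≥ X` from `X² ≤ d`. [folklore] -/
private theorem le_sqrt_of_sq_le {d : ℕ} {X : ℝ} (hX : 0 < X) (h : X ^ 2 ≤ (d : ℝ)) : X ≤ Real.sqrt d :=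
  (Real.le_sqrt' hX).2 h

/-- The sum `Σ_Q 1/a_Q` is non-negative. [folklore] -/
private theorem sum_inv_nonneg (d : ℕ) : 0 ≤ ∑ Q ∈ reducedForms (-(d : ℤ)), (1 : ℝ) / (Q.1 : ℝ) := by
  refine Finset.sum_nonneg fun Q hQ => ?_
  by_cases hD0 : (-(d : ℤ)) < 0
  · obtain ⟨-, ha, -, -⟩ := (mem_reducedForms_iff hD0).1 hQ
    have : (0 : ℝ) < Q.1 := by exact_mod_cast ha
    positivity
  · -- `d = 0`: the set is whatever it is, but every term `1/a` with `a` an integer is `≥ 0` or the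
    -- set is irrelevant; argue directly
    have hd : d = 0 := by omega
    subst hd
    simp only [CharP.cast_eq_zero, neg_zero] at hQ
    simp only [reducedForms, BinaryQuadraticForm.coeffBound, Int.natAbs_zero, Nat.zero_div,
      CharP.cast_eq_zero, neg_zero, Finset.Icc_self, Finset.mem_image, Finset.mem_filter,
      Finset.mem_product, Finset.mem_singleton] at hQ
    obtain ⟨ab, ⟨⟨ha1, -⟩, -⟩, rfl⟩ := hQ
    simp only [Finset.mem_Icc] at ha1
    have : (1 : ℝ) ≤ ab.1 := by exact_mod_cast ha1.1
    positivity

/-! ### The general step at `h(−d) ≥ 101` -/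

/-- **`h(−d) ≥ 101`, `c·(π/6 + 2.6c/√d) ≤ 10.49`, `10c ≤ √d` ⇒ `1 − β > c/√d`** for every real zero `β < 1`
of `L(s, χ)`, `χ` the odd real primitive character mod `d > 4` (`h(−d)` = number of reduced forms of
discriminant `−d`): the class-summed inequality with `10.49·Σ_Q 1/a_Q ≤ h(−d)`.
[cite: GoldfeldSchinzel1975, Theorem 1 and Corollary (case d < 0)] [cite: RalaivaosaonaRazakarinoro2026, Theorem 1 and Lemma 2] -/
theorem one_sub_realZero_gt_of_hundred_one_le {d : ℕ} [NeZero d] (hd : 4 < d)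
    {χ : DirichletCharacter ℂ d} (hprim : χ.IsPrimitive) (hquad : χ.IsQuadratic) (hodd : χ.Odd)
    (hh : 101 ≤ BinaryQuadraticForm.classNumber (-(d : ℤ)))
    {c₀ : ℝ} (hc0 : 0 < c₀) (h10 : 10 * c₀ ≤ Real.sqrt d)
    (hc : c₀ * (Real.pi / 6 + 2.6 * c₀ / Real.sqrt d) ≤ 10.49)
    {β : ℝ} (hβ1 : β < 1) (hz : χ.LFunction β = 0) : c₀ / Real.sqrt d < 1 - β := by
  have hD0 : (-(d : ℤ)) < 0 := by omega
  have hratio := BinaryQuadraticForm.LeadingCoeff.ratio_ge_of_classNumber_ge hD0 hh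
  have hS0 := sum_inv_nonneg d
  have hr : c₀ * (Real.pi / 6 + 2.6 * c₀ / Real.sqrt d) * ∑ Q ∈ reducedForms (-(d : ℤ)), (1 : ℝ) / (Q.1 : ℝ) ≤
      (BinaryQuadraticForm.classNumber (-(d : ℤ)) : ℝ) :=
    (mul_le_mul_of_nonneg_right hc hS0).trans hratio
  exact one_sub_realZero_gt_of_ratio hd hprim hquad hodd hc0 h10 hr hβ1 hz

/-- **`h(−d) ≥ 101`, `d ≥ 10⁶` ⇒ `1 − β > 18/√d`** (`18·(π/6 + 46.8/√d) ≤ 18·0.5704 < 10.49`).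
[cite: RalaivaosaonaRazakarinoro2026, Theorem 1 and Lemma 2] -/
theorem one_sub_realZero_gt_eighteen_of_classNumber_ge {d : ℕ} [NeZero d] (hd : 10 ^ 6 ≤ d)
    {χ : DirichletCharacter ℂ d} (hprim : χ.IsPrimitive) (hquad : χ.IsQuadratic) (hodd : χ.Odd)
    (hh : 101 ≤ BinaryQuadraticForm.classNumber (-(d : ℤ)))
    {β : ℝ} (hβ1 : β < 1) (hz : χ.LFunction β = 0) : 18 / Real.sqrt d < 1 - β := by
  have hdR : (10 : ℝ) ^ 6 ≤ d := by exact_mod_cast hd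
  have hsd : (1000 : ℝ) ≤ Real.sqrt d := le_sqrt_of_sq_le (by norm_num) (by nlinarith)
  have hπ := pi_div_six_lt
  have hfrac : 2.6 * 18 / Real.sqrt d ≤ 2.6 * 18 / 1000 :=
    div_le_div_of_nonneg_left (by norm_num) (by norm_num) hsd
  refine one_sub_realZero_gt_of_hundred_one_le (by omega) hprim hquad hodd hh (by norm_num)
    (by linarith) ?_ hβ1 hz
  nlinarith

/-- **`h(−d) ≥ 101`, `d ≥ 4·10⁶` ⇒ `1 − β > 19/√d`** (`19·(π/6 + 49.4/√d) ≤ 10.42 < 10.49`).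
[cite: RalaivaosaonaRazakarinoro2026, Theorem 1 and Lemma 2] -/
theorem one_sub_realZero_gt_nineteen_of_classNumber_ge {d : ℕ} [NeZero d] (hd : 4 * 10 ^ 6 ≤ d)
    {χ : DirichletCharacter ℂ d} (hprim : χ.IsPrimitive) (hquad : χ.IsQuadratic) (hodd : χ.Odd)
    (hh : 101 ≤ BinaryQuadraticForm.classNumber (-(d : ℤ)))
    {β : ℝ} (hβ1 : β < 1) (hz : χ.LFunction β = 0) : 19 / Real.sqrt d < 1 - β := by
  have hdR : (4 : ℝ) * 10 ^ 6 ≤ d := by exact_mod_cast hd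
  have hsd : (2000 : ℝ) ≤ Real.sqrt d := le_sqrt_of_sq_le (by norm_num) (by nlinarith)
  have hπ := pi_div_six_lt
  have hfrac : 2.6 * 19 / Real.sqrt d ≤ 2.6 * 19 / 2000 :=
    div_le_div_of_nonneg_left (by norm_num) (by norm_num) hsd
  refine one_sub_realZero_gt_of_hundred_one_le (by omega) hprim hquad hodd hh (by norm_num)
    (by linarith) ?_ hβ1 hz
  nlinarith

/-- **`h(−d) ≥ 101`, `d ≥ 4·10⁹` ⇒ `1 − β > 20/√d`** (`√d ≥ 63245`, `20·(π/6 + 52/63245) ≤ 10.4885 < 10.49`;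
the method's ceiling at `h ≥ 101` is `(6/π)·10.49 ≈ 20.04`). [cite: RalaivaosaonaRazakarinoro2026, Theorem 1 and Lemma 2] -/
theorem one_sub_realZero_gt_twenty_of_classNumber_ge {d : ℕ} [NeZero d] (hd : 4 * 10 ^ 9 ≤ d)
    {χ : DirichletCharacter ℂ d} (hprim : χ.IsPrimitive) (hquad : χ.IsQuadratic) (hodd : χ.Odd)
    (hh : 101 ≤ BinaryQuadraticForm.classNumber (-(d : ℤ)))
    {β : ℝ} (hβ1 : β < 1) (hz : χ.LFunction β = 0) : 20 / Real.sqrt d < 1 - β := by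
  have hdR : (4 : ℝ) * 10 ^ 9 ≤ d := by exact_mod_cast hd
  have hsd : (63245 : ℝ) ≤ Real.sqrt d := le_sqrt_of_sq_le (by norm_num) (by nlinarith)
  have hπ := pi_div_six_lt
  have hfrac : 2.6 * 20 / Real.sqrt d ≤ 2.6 * 20 / 63245 :=
    div_le_div_of_nonneg_left (by norm_num) (by norm_num) hsd
  refine one_sub_realZero_gt_of_hundred_one_le (by omega) hprim hquad hodd hh (by norm_num)
    (by linarith) ?_ hβ1 hz
  nlinarith

/-! ### Field side (`h(−d) = h_K`) -/

variable {K : Type*} [Field K] [NumberField K]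

/-- `h(−d) = h_K` for the imaginary quadratic field `K` with `d_K = −d`. [cite: Cox2013, §7.B Thm. 7.7(ii)] -/
private theorem bqfClassNumber_eq (h2 : Module.finrank ℚ K = 2) {d : ℕ} (hdK : NumberField.discr K = -(d : ℤ))
    (hd : 0 < d) : BinaryQuadraticForm.classNumber (-(d : ℤ)) = NumberField.classNumber K := by
  have hdneg : NumberField.discr K < 0 := by rw [hdK]; omega
  have hh := card_reducedForms_eq_classNumber h2 hdneg
  rwa [hdK] at hh

/-- **Field side: `h_K ≥ 101`, `d = |d_K| ≥ 10⁶` ⇒ `1 − β > 18/√d`** for the odd real primitive character mod `d`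
(the Kronecker character of the imaginary quadratic field `K`). [cite: RalaivaosaonaRazakarinoro2026, Theorem 1 and Lemma 2] -/
theorem one_sub_realZero_gt_eighteen_of_classNumber_ge_field (h2 : Module.finrank ℚ K = 2) {d : ℕ} [NeZero d]
    (hdK : NumberField.discr K = -(d : ℤ)) (hd : 10 ^ 6 ≤ d) {χ : DirichletCharacter ℂ d}
    (hprim : χ.IsPrimitive) (hquad : χ.IsQuadratic) (hodd : χ.Odd) (hh : 101 ≤ NumberField.classNumber K)
    {β : ℝ} (hβ1 : β < 1) (hz : χ.LFunction β = 0) : 18 / Real.sqrt d < 1 - β :=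
  one_sub_realZero_gt_eighteen_of_classNumber_ge hd hprim hquad hodd
    (by rw [bqfClassNumber_eq h2 hdK (by omega)]; exact hh) hβ1 hz

/-- **Field side, `19/√d`** (`h_K ≥ 101`, `d ≥ 4·10⁶`). [cite: RalaivaosaonaRazakarinoro2026, Theorem 1 and Lemma 2] -/
theorem one_sub_realZero_gt_nineteen_of_classNumber_ge_field (h2 : Module.finrank ℚ K = 2) {d : ℕ} [NeZero d]
    (hdK : NumberField.discr K = -(d : ℤ)) (hd : 4 * 10 ^ 6 ≤ d) {χ : DirichletCharacter ℂ d}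
    (hprim : χ.IsPrimitive) (hquad : χ.IsQuadratic) (hodd : χ.Odd) (hh : 101 ≤ NumberField.classNumber K)
    {β : ℝ} (hβ1 : β < 1) (hz : χ.LFunction β = 0) : 19 / Real.sqrt d < 1 - β :=
  one_sub_realZero_gt_nineteen_of_classNumber_ge hd hprim hquad hodd
    (by rw [bqfClassNumber_eq h2 hdK (by omega)]; exact hh) hβ1 hz

/-- **Field side, `20/√d`** (`h_K ≥ 101`, `d ≥ 4·10⁹`). [cite: RalaivaosaonaRazakarinoro2026, Theorem 1 and Lemma 2] -/
theorem one_sub_realZero_gt_twenty_of_classNumber_ge_field (h2 : Module.finrank ℚ K = 2) {d : ℕ} [NeZero d]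
    (hdK : NumberField.discr K = -(d : ℤ)) (hd : 4 * 10 ^ 9 ≤ d) {χ : DirichletCharacter ℂ d}
    (hprim : χ.IsPrimitive) (hquad : χ.IsQuadratic) (hodd : χ.Odd) (hh : 101 ≤ NumberField.classNumber K)
    {β : ℝ} (hβ1 : β < 1) (hz : χ.LFunction β = 0) : 20 / Real.sqrt d < 1 - β :=
  one_sub_realZero_gt_twenty_of_classNumber_ge hd hprim hquad hodd
    (by rw [bqfClassNumber_eq h2 hdK (by omega)]; exact hh) hβ1 hz

/-! ### Modulo Watkins' Table 4: all odd conductors `d > 2 383 747` -/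

/-- `h(−d) ≥ 101` for every odd real primitive character mod `d > 2 383 747`, modulo Watkins' Table 4
(`Watkins2004.hundred_lt_classNumber` on the imaginary quadratic field of discriminant `−d`).
[cite: Watkins2004ClassNumbers, Table 4 p. 936] -/
theorem hundred_one_le_classNumber_of_watkins (hW : watkins2004_table4) {d : ℕ} [NeZero d] (hd : 2383747 < d)
    {χ : DirichletCharacter ℂ d} (hprim : χ.IsPrimitive) (hquad : χ.IsQuadratic) (hodd : χ.Odd) :
    101 ≤ BinaryQuadraticForm.classNumber (-(d : ℤ)) := by
  obtain ⟨K, instF, instNF, h2, hdK⟩ := exists_quadraticField_of_odd_primitive hprim hquad hodd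
  have hdneg : NumberField.discr K < 0 := by rw [hdK]; omega
  have hnat : (NumberField.discr K).natAbs = d := by rw [hdK]; simp
  have h101 := Watkins2004.hundred_lt_classNumber hW K h2 hdneg (by rw [hnat]; exact hd)
  rw [bqfClassNumber_eq h2 hdK (by omega)]
  omega

/-- **Every odd `d > 2 383 747`: `1 − β > 18/√d`** for every real zero `β < 1` of `L(s, χ)`, `χ` the odd real
primitive character mod `d` — modulo Watkins' class-number Table 4 (the input Ralaivaosaona–Razakarinoro use for
`6.035/√d`). [cite: RalaivaosaonaRazakarinoro2026, Theorem 1] [cite: Watkins2004ClassNumbers, Table 4 p. 936] -/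
theorem one_sub_realZero_gt_eighteen_of_watkins (hW : watkins2004_table4) {d : ℕ} [NeZero d]
    (hd : 2383747 < d) {χ : DirichletCharacter ℂ d}
    (hprim : χ.IsPrimitive) (hquad : χ.IsQuadratic) (hodd : χ.Odd)
    {β : ℝ} (hβ1 : β < 1) (hz : χ.LFunction β = 0) : 18 / Real.sqrt d < 1 - β :=
  one_sub_realZero_gt_eighteen_of_classNumber_ge (by omega) hprim hquad hodd
    (hundred_one_le_classNumber_of_watkins hW hd hprim hquad hodd) hβ1 hz

/-- **Every odd `d ≥ 4·10⁶`: `1 − β > 19/√d`**, modulo Watkins' Table 4.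
[cite: RalaivaosaonaRazakarinoro2026, Theorem 1] [cite: Watkins2004ClassNumbers, Table 4 p. 936] -/
theorem one_sub_realZero_gt_nineteen_of_watkins (hW : watkins2004_table4) {d : ℕ} [NeZero d]
    (hd : 4 * 10 ^ 6 ≤ d) {χ : DirichletCharacter ℂ d}
    (hprim : χ.IsPrimitive) (hquad : χ.IsQuadratic) (hodd : χ.Odd)
    {β : ℝ} (hβ1 : β < 1) (hz : χ.LFunction β = 0) : 19 / Real.sqrt d < 1 - β :=
  one_sub_realZero_gt_nineteen_of_classNumber_ge hd hprim hquad hodd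
    (hundred_one_le_classNumber_of_watkins hW (by omega) hprim hquad hodd) hβ1 hz

/-- **Every odd `d ≥ 4·10⁹`: `1 − β > 20/√d`**, modulo Watkins' Table 4.
[cite: RalaivaosaonaRazakarinoro2026, Theorem 1] [cite: Watkins2004ClassNumbers, Table 4 p. 936] -/
theorem one_sub_realZero_gt_twenty_of_watkins (hW : watkins2004_table4) {d : ℕ} [NeZero d]
    (hd : 4 * 10 ^ 9 ≤ d) {χ : DirichletCharacter ℂ d}
    (hprim : χ.IsPrimitive) (hquad : χ.IsQuadratic) (hodd : χ.Odd)
    {β : ℝ} (hβ1 : β < 1) (hz : χ.LFunction β = 0) : 20 / Real.sqrt d < 1 - β :=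
  one_sub_realZero_gt_twenty_of_classNumber_ge hd hprim hquad hodd
    (hundred_one_le_classNumber_of_watkins hW (by omega) hprim hquad hodd) hβ1 hz

/-- **Ralaivaosaona–Razakarinoro 2026, Theorem 1, DERIVED from Watkins' Table 4**: the typed named fact
`ralaivaosaonaRazakarinoro2026_theorem1` (`d > 3·10⁸`, odd real primitive `χ`, `L(β, χ) = 0`, `β > 0` ⇒
`1 − β > 6.035/√d`) follows from `watkins2004_table4` by the kernel bound `18/√d` (`β < 1` because
`L(s, χ) ≠ 0` on `Re s ≥ 1`). [cite: RalaivaosaonaRazakarinoro2026, Theorem 1] [cite: Watkins2004ClassNumbers, Table 4 p. 936] -/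
theorem ralaivaosaonaRazakarinoro2026_theorem1_of_watkins (hW : watkins2004_table4) :
    ralaivaosaonaRazakarinoro2026_theorem1 := by
  intro d _ hd χ hquad hprim hodd β _ hz
  have hχ1 : χ ≠ 1 := by
    intro h
    have h1 : χ (-1) = -1 := hodd
    rw [h, MulChar.one_apply (isUnit_one.neg)] at h1
    norm_num at h1
  have hβ1 : β < 1 := by
    by_contra hge
    push Not at hge
    exact χ.LFunction_ne_zero_of_one_le_re (Or.inl hχ1) (by simpa using hge) hz
  have h18 := one_sub_realZero_gt_eighteen_of_watkins hW (by omega) hprim hquad hodd hβ1 hz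
  have hdR : (0 : ℝ) < d := by exact_mod_cast (show 0 < d by omega)
  have hsd0 : 0 < Real.sqrt d := Real.sqrt_pos.2 hdR
  have : 6.035 / Real.sqrt d < 18 / Real.sqrt d := div_lt_div_of_pos_right (by norm_num) hsd0
  linarith

/-! ### Small class numbers: `h(−d) ≥ 2` already gives `2.5/√d` -/

/-- **`h(−d) ≥ 2`, `d ≥ 5·10⁵` ⇒ `1 − β > 2.5/√d`**: exactly one reduced form has `a = 1`, so
`Σ_Q 1/a_Q ≤ (h+1)/2 ≤ 3h/4` and the class-summed inequality runs with `c(π/6 + 2.6c/√d) ≤ 4/3`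
(Pintz's `12/π · h/(h+1)` mechanism). [cite: GoldfeldSchinzel1975, Theorem 1 and Corollary (case d < 0)] -/
theorem one_sub_realZero_gt_five_halves_of_two_le {d : ℕ} [NeZero d] (hd : 5 * 10 ^ 5 ≤ d)
    {χ : DirichletCharacter ℂ d} (hprim : χ.IsPrimitive) (hquad : χ.IsQuadratic) (hodd : χ.Odd)
    (hh : 2 ≤ BinaryQuadraticForm.classNumber (-(d : ℤ)))
    {β : ℝ} (hβ1 : β < 1) (hz : χ.LFunction β = 0) : 2.5 / Real.sqrt d < 1 - β := by
  have hD0 : (-(d : ℤ)) < 0 := by omega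
  have hdR : (5 : ℝ) * 10 ^ 5 ≤ d := by exact_mod_cast hd
  have hsd : (707 : ℝ) ≤ Real.sqrt d := le_sqrt_of_sq_le (by norm_num) (by nlinarith)
  have hπ := pi_div_six_lt
  have hfrac : 2.6 * 2.5 / Real.sqrt d ≤ 2.6 * 2.5 / 707 :=
    div_le_div_of_nonneg_left (by norm_num) (by norm_num) hsd
  have hhalf := BinaryQuadraticForm.LeadingCoeff.sum_inv_fst_le_half hD0
  have hhR : (2 : ℝ) ≤ BinaryQuadraticForm.classNumber (-(d : ℤ)) := by exact_mod_cast hh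
  have hS0 := sum_inv_nonneg d
  have hc : 2.5 * (Real.pi / 6 + 2.6 * 2.5 / Real.sqrt d) ≤ 4 / 3 := by nlinarith
  have hr : 2.5 * (Real.pi / 6 + 2.6 * 2.5 / Real.sqrt d) * ∑ Q ∈ reducedForms (-(d : ℤ)), (1 : ℝ) / (Q.1 : ℝ) ≤
      (BinaryQuadraticForm.classNumber (-(d : ℤ)) : ℝ) := by
    have h1 : 2.5 * (Real.pi / 6 + 2.6 * 2.5 / Real.sqrt d) * ∑ Q ∈ reducedForms (-(d : ℤ)), (1 : ℝ) / (Q.1 : ℝ) ≤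
        4 / 3 * ∑ Q ∈ reducedForms (-(d : ℤ)), (1 : ℝ) / (Q.1 : ℝ) := mul_le_mul_of_nonneg_right hc hS0
    nlinarith
  exact one_sub_realZero_gt_of_ratio (by omega) hprim hquad hodd (by norm_num) (by linarith) hr hβ1 hz

/-- **Every odd `d ≥ 5·10⁵`: `1 − β > 2.5/√d`, modulo the class number one theorem** (Heegner–Baker–Stark,
Cox Thm. 7.30(ii), tree named fact `mem_classNumberOneDiscrs_of_classNumber_eq_one`): `h(−d) ≠ 1` for
`d > 163`, and `h(−d) ≥ 1` (the principal form; `−d ≡ 0, 1 (mod 4)` for the conductor of an odd real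
primitive character). [cite: Cox2013, §7.D Thm. 7.30(ii)] [cite: GoldfeldSchinzel1975, Theorem 1 and Corollary (case d < 0)] -/
theorem one_sub_realZero_gt_five_halves_of_classNumberOne (hCN : mem_classNumberOneDiscrs_of_classNumber_eq_one)
    {d : ℕ} [NeZero d] (hd : 5 * 10 ^ 5 ≤ d)
    {χ : DirichletCharacter ℂ d} (hprim : χ.IsPrimitive) (hquad : χ.IsQuadratic) (hodd : χ.Odd)
    {β : ℝ} (hβ1 : β < 1) (hz : χ.LFunction β = 0) : 2.5 / Real.sqrt d < 1 - β := by
  have hD0 : (-(d : ℤ)) < 0 := by omega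
  have h4 : (-(d : ℤ)) % 4 = 0 ∨ (-(d : ℤ)) % 4 = 1 := by
    rcases isFundamentalDiscriminant_neg hprim hquad hodd with ⟨h1, -, -⟩ | ⟨h0, -, -⟩
    · exact Or.inr h1
    · exact Or.inl (Int.emod_eq_zero_of_dvd h0)
  have hpos : 0 < BinaryQuadraticForm.classNumber (-(d : ℤ)) :=
    BinaryQuadraticForm.classNumber_pos hD0 h4
  have hne : BinaryQuadraticForm.classNumber (-(d : ℤ)) ≠ 1 := by
    intro h1
    have hmem := hCN _ hD0 h4 h1
    simp only [classNumberOneDiscrs, Finset.mem_insert, Finset.mem_singleton] at hmem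
    omega
  exact one_sub_realZero_gt_five_halves_of_two_le hd hprim hquad hodd (by omega) hβ1 hz

/-! ### Readings on the column's predicate `IsSiegelZero` -/

/-- **Quality cap at an odd character with `h(−d) ≥ 101`**: a Tao–Teräväinen Siegel zero of `χ` (odd,
`d ≥ 10⁶`) has quality `η < √d/(18 log d)` (`β₀ = 1 − 1/(η log d)` is a real zero `< 1`).
[cite: TaoTeravainen2021, Definition 1.4] [cite: RalaivaosaonaRazakarinoro2026, Theorem 1] -/
theorem isSiegelZero_quality_lt_of_hundred_one_le {d : ℕ} [NeZero d] (hd : 10 ^ 6 ≤ d)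
    {χ : DirichletCharacter ℂ d} {η : ℝ} (hS : IsSiegelZero χ η) (hodd : χ.Odd)
    (hh : 101 ≤ BinaryQuadraticForm.classNumber (-(d : ℤ))) :
    η < Real.sqrt d / (18 * Real.log d) := by
  obtain ⟨hprim, hquad, h10, hzero⟩ := hS
  have hdR : (10 : ℝ) ^ 6 ≤ d := by exact_mod_cast hd
  have hlog : 0 < Real.log d := Real.log_pos (by linarith)
  have hη0 : 0 < η := by linarith
  have hβ1 : 1 - 1 / (η * Real.log d) < 1 := by
    have : 0 < 1 / (η * Real.log d) := by positivity
    linarith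
  have h := one_sub_realZero_gt_eighteen_of_classNumber_ge hd hprim hquad hodd hh hβ1 (by exact_mod_cast hzero)
  rw [show (1 : ℝ) - (1 - 1 / (η * Real.log d)) = 1 / (η * Real.log d) by ring] at h
  have hsd0 : 0 < Real.sqrt d := Real.sqrt_pos.2 (by linarith)
  rw [div_lt_div_iff₀ hsd0 (by positivity)] at h
  rw [lt_div_iff₀ (by positivity)]
  linarith

/-- **Quality cap for every odd `d > 2 383 747`, modulo Watkins' Table 4**: `η < √d/(18 log d)`
(v4, hypothesis-free: `η < √d/(1.5 log d)` for `d ≥ 441`). [cite: TaoTeravainen2021, Definition 1.4]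
[cite: Watkins2004ClassNumbers, Table 4 p. 936] -/
theorem isSiegelZero_quality_lt_of_watkins (hW : watkins2004_table4) {d : ℕ} [NeZero d]
    (hd : 2383747 < d) {χ : DirichletCharacter ℂ d} {η : ℝ} (hS : IsSiegelZero χ η) (hodd : χ.Odd) :
    η < Real.sqrt d / (18 * Real.log d) :=
  isSiegelZero_quality_lt_of_hundred_one_le (by omega) hS hodd
    (hundred_one_le_classNumber_of_watkins hW hd hS.1 hS.2.1 hodd)

/-! ### All odd conductors, modulo the printed / certified zero-free tables -/

/-- **Every odd conductor `d ≥ 3`: `1 − β > 18/√d` for every real zero `β ∈ (0, 1)`**, modulo Watkins' two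
2004 theorems (no positive real zero for `d ≤ 3·10⁸`, `watkins2004_theorem`; class numbers `≤ 100`,
`watkins2004_table4`) — the exact inputs of Ralaivaosaona–Razakarinoro's `6.035/√d`.
[cite: RalaivaosaonaRazakarinoro2026, Theorem 1] [cite: Watkins2004RealZeros, main theorem]
[cite: Watkins2004ClassNumbers, Table 4 p. 936] -/
theorem one_sub_realZero_gt_eighteen_all_of_watkins (hZ : watkins2004_theorem) (hW : watkins2004_table4)
    {d : ℕ} [NeZero d] (hd : 3 ≤ d) {χ : DirichletCharacter ℂ d}
    (hprim : χ.IsPrimitive) (hquad : χ.IsQuadratic) (hodd : χ.Odd)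
    {β : ℝ} (hβ0 : 0 < β) (hβ1 : β < 1) (hz : χ.LFunction β = 0) : 18 / Real.sqrt d < 1 - β := by
  rcases le_or_gt d 300000000 with hle | hgt
  · exact absurd hz (hZ d hd hle χ hquad hprim hodd β hβ0 hβ1)
  · exact one_sub_realZero_gt_eighteen_of_watkins hW (by omega) hprim hquad hodd hβ1 hz

/-- **Every odd conductor `d ≥ 3`: `1 − β > 20/√d` for every real zero `β ∈ (0, 1)`**, modulo the cell's
certified rung leaf `NoRealZeroOddUpTo_3e10` (odd real characters, `q ≤ 3·10¹⁰`; certified numerics,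
value-free until booked) and Watkins' Table 4: the leaf covers `d ≤ 3·10¹⁰ ⊇ [3, 4·10⁹]`, beyond it
`one_sub_realZero_gt_twenty_of_watkins`. [cite: RalaivaosaonaRazakarinoro2026, Theorem 1]
[cite: Watkins2004ClassNumbers, Table 4 p. 936] -/
theorem one_sub_realZero_gt_twenty_all_of_leaf_3e10 (hL : NoRealZeroOddUpTo_3e10) (hW : watkins2004_table4)
    {d : ℕ} [NeZero d] (hd : 3 ≤ d) {χ : DirichletCharacter ℂ d}
    (hprim : χ.IsPrimitive) (hquad : χ.IsQuadratic) (hodd : χ.Odd)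
    {β : ℝ} (hβ0 : 0 < β) (hβ1 : β < 1) (hz : χ.LFunction β = 0) : 20 / Real.sqrt d < 1 - β := by
  rcases le_or_gt d 30000000000 with hle | hgt
  · exact absurd hz (hL d hd hle χ hquad hprim hodd β hβ0 hβ1)
  · exact one_sub_realZero_gt_twenty_of_watkins hW (by omega) hprim hquad hodd hβ1 hz


/-! ### Every odd conductor, modulo the class-number table ALONE: `1 − β > 2.5/√d` (appended) -/

/-- **`Σ_Q 1/a_Q ≤ h(D)/3 + 1`** (`N = 2` in the rearrangement: one form with `a = 1`, at most two with `a = 2`).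
[cite: RalaivaosaonaRazakarinoro2026, Lemma 2] -/
theorem sum_inv_fst_le_third {D : ℤ} (hD : D < 0) :
    ∑ Q ∈ reducedForms D, (1 : ℝ) / (Q.1 : ℝ) ≤ (BinaryQuadraticForm.classNumber D : ℝ) / 3 + 1 := by
  have ha : ∀ Q ∈ reducedForms D, (1 : ℤ) ≤ Q.1 := fun Q hQ => by
    obtain ⟨-, ha, -, -⟩ := (mem_reducedForms_iff hD).1 hQ; omega
  have h := BinaryQuadraticForm.LeadingCoeff.sum_one_div_le_of_card_fiber_le (reducedForms D) (fun Q => Q.1) ha 2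
    (fun k => [1,2,2,2,2,4,2,4,3,4,2,4,2,4,4,4,2,6,2,4,4,4,2,8,5,4,6,4,2].getD k 0)
    (fun k hk => BinaryQuadraticForm.LeadingCoeff.card_fiber_le_table hD k (by omega))
  have hc : ((reducedForms D).card : ℝ) = (BinaryQuadraticForm.classNumber D : ℝ) := rfl
  rw [hc] at h
  simp only [Finset.sum_range_succ, Finset.sum_range_zero, List.getD_cons_zero, List.getD_cons_succ,
    Nat.cast_ofNat, Nat.cast_one, Nat.cast_zero] at h
  norm_num at h ⊢
  linarith

/-- **`h(−d) ≥ 5`, `d > 1555` ⇒ `1 − β > 2.5/√d`** (`h/(h/3 + 1) ≥ 1.875` for `h ≥ 5`;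
`√d > 39`, `2.5·(π/6 + 6.5/39) ≤ 2.5·0.6903 < 1.875`). [cite: GoldfeldSchinzel1975, Theorem 1 and Corollary (case d < 0)] -/
theorem one_sub_realZero_gt_five_halves_of_five_le {d : ℕ} [NeZero d] (hd : 1555 < d)
    {χ : DirichletCharacter ℂ d} (hprim : χ.IsPrimitive) (hquad : χ.IsQuadratic) (hodd : χ.Odd)
    (hh : 5 ≤ BinaryQuadraticForm.classNumber (-(d : ℤ)))
    {β : ℝ} (hβ1 : β < 1) (hz : χ.LFunction β = 0) : 2.5 / Real.sqrt d < 1 - β := by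
  have hD0 : (-(d : ℤ)) < 0 := by omega
  have hdR : (1556 : ℝ) ≤ d := by exact_mod_cast hd
  have hsd : (39 : ℝ) ≤ Real.sqrt d := le_sqrt_of_sq_le (by norm_num) (by nlinarith)
  have hπ := pi_div_six_lt
  have hfrac : 2.6 * 2.5 / Real.sqrt d ≤ 2.6 * 2.5 / 39 :=
    div_le_div_of_nonneg_left (by norm_num) (by norm_num) hsd
  have hthird := sum_inv_fst_le_third hD0
  have hhR : (5 : ℝ) ≤ BinaryQuadraticForm.classNumber (-(d : ℤ)) := by exact_mod_cast hh
  have hS0 := sum_inv_nonneg d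
  have hc : 2.5 * (Real.pi / 6 + 2.6 * 2.5 / Real.sqrt d) ≤ 1.875 := by nlinarith
  have hr : 2.5 * (Real.pi / 6 + 2.6 * 2.5 / Real.sqrt d) * ∑ Q ∈ reducedForms (-(d : ℤ)), (1 : ℝ) / (Q.1 : ℝ) ≤
      (BinaryQuadraticForm.classNumber (-(d : ℤ)) : ℝ) := by
    have h1 : 2.5 * (Real.pi / 6 + 2.6 * 2.5 / Real.sqrt d) * ∑ Q ∈ reducedForms (-(d : ℤ)), (1 : ℝ) / (Q.1 : ℝ) ≤
        1.875 * ∑ Q ∈ reducedForms (-(d : ℤ)), (1 : ℝ) / (Q.1 : ℝ) := mul_le_mul_of_nonneg_right hc hS0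
    nlinarith
  exact one_sub_realZero_gt_of_ratio (by omega) hprim hquad hodd (by norm_num) (by linarith) hr hβ1 hz

/-- `large(N) ≤ 1555` for `N ≤ 4` in Watkins' Table 4 (`163, 427, 907, 1555`).
[cite: Watkins2004ClassNumbers, Table 4 p. 936] -/
private theorem largest_le_1555 {N : ℕ} (hN : N ≤ 4) : Watkins2004.largest N ≤ 1555 := by
  interval_cases N <;> decide

/-- **`h(−d) ≥ 5` for every odd real primitive character mod `d > 1555`, modulo Watkins' Table 4** (the
imaginary quadratic fields with `h_K ≤ 4` have `|d_K| ≤ 1555`). [cite: Watkins2004ClassNumbers, Table 4 p. 936] -/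
theorem five_le_classNumber_of_watkins (hW : watkins2004_table4) {d : ℕ} [NeZero d] (hd : 1555 < d)
    {χ : DirichletCharacter ℂ d} (hprim : χ.IsPrimitive) (hquad : χ.IsQuadratic) (hodd : χ.Odd) :
    5 ≤ BinaryQuadraticForm.classNumber (-(d : ℤ)) := by
  obtain ⟨K, instF, instNF, h2, hdK⟩ := exists_quadraticField_of_odd_primitive hprim hquad hodd
  have hdneg : NumberField.discr K < 0 := by rw [hdK]; omega
  have hnat : (NumberField.discr K).natAbs = d := by rw [hdK]; simp
  rw [bqfClassNumber_eq h2 hdK (by omega)]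
  by_contra hlt
  push Not at hlt
  have h4 : NumberField.classNumber K ≤ 4 := by omega
  have hle := Watkins2004.natAbs_discr_le_largest hW K h2 hdneg (by omega)
  have := largest_le_1555 h4
  rw [hnat] at hle
  omega

/-- **Every odd conductor `d > 1555`: `1 − β > 2.5/√d` for every real zero `β < 1`, kernel modulo Watkins'
CLASS-NUMBER Table 4 alone** (no zero-free table: `h ≤ 4 ⇒ d ≤ 1555`, so `h(−d) ≥ 5`, then the class-summed
inequality). Below `d = 5000` the kernel floor leaves no real zero in `(0, 1)` at all
(`ClassSumRepulsion.conductor_gt_5000_of_realZero`, `RealZeroRepulsionOddAllConductors.lean`); the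
hypothesis-free constant for all odd `d > 4` is `1.5` (`one_sub_realZero_gt_three_halves_of_odd_all`).
[cite: GoldfeldSchinzel1975, Theorem 1 and Corollary (case d < 0)] [cite: Watkins2004ClassNumbers, Table 4 p. 936] -/
theorem one_sub_realZero_gt_five_halves_of_watkins (hW : watkins2004_table4) {d : ℕ} [NeZero d]
    (hd : 1555 < d) {χ : DirichletCharacter ℂ d} (hprim : χ.IsPrimitive) (hquad : χ.IsQuadratic) (hodd : χ.Odd)
    {β : ℝ} (hβ1 : β < 1) (hz : χ.LFunction β = 0) : 2.5 / Real.sqrt d < 1 - β :=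
  one_sub_realZero_gt_five_halves_of_five_le hd hprim hquad hodd
    (five_le_classNumber_of_watkins hW hd hprim hquad hodd) hβ1 hz

end ClassSumRepulsion

end Literature.NumberTheory.LFunctions
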